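import Mathlib.Analysis.SpecialFunctions.Complex.Arg
import Mathlib.Analysis.SpecialFunctions.Sqrt
import Literature.Analysis.FluidPDE.AxisymmetricEuler
import HarnessLib

/-!
# Axisymmetric scalars as functions on the meridian half-plane

Analysis/FluidPDE support file on the decomposition path of `Literature.Analysis.FluidPDE.chen_hou_blowup` (Chen–Hou,
Part I §6, p. 53, work with functions of the cylindrical coordinates `(r, z) ∈ [0, 1] × 𝕋`; the
tree's axisymmetric vocabulary `AxisymmetricEuler` lives on `ℝ³`). This file provides the
dictionary between an axisymmetric scalar field `g` on `ℝ³` and its meridian profile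
`G(r, z) = g(r, 0, z)`:

* `Fluid.meridian x = (r, z) = (cylRadius x, x 2)` and the meridian embedding
  `Fluid.meridianPoint (r, z) = (r, 0, z)`;
* `IsAxisymmetricScalar.eq_comp_meridian`: `g = G ∘ meridian` with `G = g ∘ meridianPoint`
  (rotate `x` to the meridian plane by the angle `arg (x₀ + i x₁)`);
* calculus off the axis: `D r (x) = ⟪e_r(x), ·⟫` (`hasFDerivAt_cylRadius`), the chain rule
  `D(G ∘ meridian)(x) h = DG(r, z)(⟪e_r, h⟫, h₂)` (`fderiv_comp_meridian_apply`), hence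
  `(u·∇)(G ∘ meridian) = DG(r,z)(u_r, u_z) = u^r ∂ᵣG + u^z ∂_zG` (`convect_comp_meridian`),
  `∂_{e_z}(G ∘ meridian) = ∂_zG`, `∂_{e_r}(G ∘ meridian) = ∂ᵣG`
  (`partialDeriv_eZ_comp_meridian`, `partialDeriv_eR_comp_meridian`).

This is the form `∂ₜ + u^r ∂ᵣ + u^z ∂_z` of the material derivative on axisymmetric scalars used in
Chen–Hou's system (6.1)/(6.6). All statements are folklore calculus.
-/

noncomputable section

open Set Function Filter Topology WithLp
open scoped InnerProductSpace RealInnerProductSpace ContDiff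

namespace Literature.Analysis.FluidPDE

/-- Local notation for physical space `ℝ³ = EuclideanSpace ℝ (Fin 3)`. -/
local notation "ℝ³" => EuclideanSpace ℝ (Fin 3)

/-! ### The meridian projection and embedding -/

/-- The meridian (cylindrical) coordinates `π(x) = (r, z) = (cylRadius x, x 2)` of a point of
`ℝ³` (Chen–Hou, Part I §6 Notations, p. 53: `r = √(x₁² + x₂²)`, `z = x₃`). [cite: arXiv221007191, §6 Notations p. 53] -/
def meridian (x : ℝ³) : ℝ × ℝ :=
  (cylRadius x, x 2)

/-- The point `(r, 0, z)` of the meridian half-plane `{x₁ = 0, x₀ ≥ 0}` with coordinates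
`(r, z)`. [folklore] -/
def meridianPoint (q : ℝ × ℝ) : ℝ³ :=
  toLp 2 ![q.1, 0, q.2]

/-- Unfolding `meridian`. [folklore] -/
@[simp] theorem meridian_apply (x : ℝ³) : meridian x = (cylRadius x, x 2) := rfl

/-- Components of the meridian point. [folklore] -/
@[simp] theorem meridianPoint_apply_zero (q : ℝ × ℝ) : meridianPoint q 0 = q.1 := rfl

/-- Components of the meridian point. [folklore] -/
@[simp] theorem meridianPoint_apply_one (q : ℝ × ℝ) : meridianPoint q 1 = 0 := rfl

/-- Components of the meridian point. [folklore] -/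
@[simp] theorem meridianPoint_apply_two (q : ℝ × ℝ) : meridianPoint q 2 = q.2 := rfl

/-- The meridian coordinates of `(r, 0, z)` are `(|r|, z)`; for `r ≥ 0`, `(r, z)`. [folklore] -/
theorem meridian_meridianPoint {q : ℝ × ℝ} (hq : 0 ≤ q.1) : meridian (meridianPoint q) = q := by
  obtain ⟨r, z⟩ := q
  simp only [meridian_apply, cylRadius, meridianPoint_apply_zero, meridianPoint_apply_one,
    meridianPoint_apply_two, Prod.mk.injEq, and_true]
  rw [show r ^ 2 + (0 : ℝ) ^ 2 = r ^ 2 by ring, Real.sqrt_sq hq]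

/-- The meridian embedding is a continuous linear map (hence smooth). [folklore] -/
theorem contDiff_meridianPoint {n : WithTop ℕ∞} : ContDiff ℝ n meridianPoint := by
  rw [contDiff_euclidean]
  intro i
  fin_cases i
  · exact contDiff_fst
  · exact contDiff_const
  · exact contDiff_snd

/-! ### Representation of axisymmetric scalars -/

/-- **Rotation to the meridian plane**: every `x` is the rotation by `θ = arg (x₀ + i x₁)` of the
meridian point `(r, 0, z)`, `r = cylRadius x`, `z = x 2`. [folklore] -/
theorem rotZ_arg_meridianPoint (x : ℝ³) :
    rotZ (Complex.arg ⟨x 0, x 1⟩) (meridianPoint (meridian x)) = x := by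
  have hr : ‖(⟨x 0, x 1⟩ : ℂ)‖ = cylRadius x := by
    rw [Complex.norm_def, Complex.normSq_mk, cylRadius]
    congr 1; ring
  have hc := Complex.norm_mul_cos_arg (⟨x 0, x 1⟩ : ℂ)
  have hs := Complex.norm_mul_sin_arg (⟨x 0, x 1⟩ : ℂ)
  rw [hr] at hc hs
  have e0 : rotZ (Complex.arg ⟨x 0, x 1⟩) (meridianPoint (meridian x)) 0 = x 0 := by
    rw [rotZ_apply_zero, meridianPoint_apply_zero, meridianPoint_apply_one, meridian_apply]
    linear_combination hc
  have e1 : rotZ (Complex.arg ⟨x 0, x 1⟩) (meridianPoint (meridian x)) 1 = x 1 := by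
    rw [rotZ_apply_one, meridianPoint_apply_zero, meridianPoint_apply_one, meridian_apply]
    linear_combination hs
  have e2 : rotZ (Complex.arg ⟨x 0, x 1⟩) (meridianPoint (meridian x)) 2 = x 2 := by
    rw [rotZ_apply_two, meridianPoint_apply_two, meridian_apply]
  ext i
  fin_cases i
  exacts [e0, e1, e2]

/-- **An axisymmetric scalar is a function of `(r, z)`**: `g x = G (meridian x)` with the meridian
profile `G = g ∘ meridianPoint`, `G(r, z) = g(r, 0, z)` (KNSS 2009, §1: "`f = f(r, z)`";
Chen–Hou, Part I §6, p. 53). [folklore] -/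
theorem IsAxisymmetricScalar.eq_comp_meridian {α : Sort*} {g : ℝ³ → α}
    (hg : IsAxisymmetricScalar g) (x : ℝ³) : g x = g (meridianPoint (meridian x)) := by
  conv_lhs => rw [← rotZ_arg_meridianPoint x]
  exact hg _ _

/-- Function form of `IsAxisymmetricScalar.eq_comp_meridian`: `g = (g ∘ meridianPoint) ∘ meridian`. [folklore] -/
theorem IsAxisymmetricScalar.eq_comp_meridian' {α : Sort*} {g : ℝ³ → α}
    (hg : IsAxisymmetricScalar g) : g = fun x => (g ∘ meridianPoint) (meridian x) :=
  funext fun x => hg.eq_comp_meridian x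

/-- The meridian profile of a `Cⁿ` scalar is `Cⁿ` (on all of `ℝ²`). [folklore] -/
theorem ContDiff.comp_meridianPoint {F : Type*} [NormedAddCommGroup F] [NormedSpace ℝ F]
    {g : ℝ³ → F} {n : WithTop ℕ∞} (hg : ContDiff ℝ n g) : ContDiff ℝ n (g ∘ meridianPoint) :=
  hg.comp contDiff_meridianPoint

/-! ### Calculus off the axis -/

/-- **The gradient of `r` is `e_r`**: off the axis, `D(cylRadius)(x) h = ⟪eR x, h⟫`. [folklore] -/
theorem hasFDerivAt_cylRadius {x : ℝ³} (hx : cylRadius x ≠ 0) :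
    HasFDerivAt cylRadius (innerSL ℝ (eR x)) x := by
  have h0 : HasFDerivAt (fun y : ℝ³ => y 0) (EuclideanSpace.proj (0 : Fin 3) : ℝ³ →L[ℝ] ℝ) x :=
    (EuclideanSpace.proj (0 : Fin 3) : ℝ³ →L[ℝ] ℝ).hasFDerivAt
  have h1 : HasFDerivAt (fun y : ℝ³ => y 1) (EuclideanSpace.proj (1 : Fin 3) : ℝ³ →L[ℝ] ℝ) x :=
    (EuclideanSpace.proj (1 : Fin 3) : ℝ³ →L[ℝ] ℝ).hasFDerivAt
  have hsq : HasFDerivAt (fun y : ℝ³ => y 0 ^ 2 + y 1 ^ 2)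
      ((2 * x 0) • (EuclideanSpace.proj (0 : Fin 3) : ℝ³ →L[ℝ] ℝ) +
        (2 * x 1) • (EuclideanSpace.proj (1 : Fin 3) : ℝ³ →L[ℝ] ℝ)) x := by
    have e : (fun y : ℝ³ => y 0 ^ 2 + y 1 ^ 2) = fun y : ℝ³ => y 0 * y 0 + y 1 * y 1 :=
      funext fun y => by ring
    rw [e]
    refine ((h0.mul h0).add (h1.mul h1)).congr_fderiv ?_
    ext h
    simp only [_root_.add_apply, _root_.smul_apply, smul_eq_mul, PiLp.proj_apply]
    ring
  have hne : x 0 ^ 2 + x 1 ^ 2 ≠ 0 := by rw [← cylRadius_sq]; exact pow_ne_zero 2 hx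
  have h := hsq.sqrt hne
  have hr : Real.sqrt (x 0 ^ 2 + x 1 ^ 2) = cylRadius x := rfl
  rw [hr] at h
  refine h.congr_fderiv ?_
  ext v
  simp only [_root_.smul_apply, _root_.add_apply, smul_eq_mul, PiLp.proj_apply,
    innerSL_apply_apply, eR, inner_smul_left, PiLp.inner_apply,
    RCLike.inner_apply, conj_trivial, Fin.sum_univ_three, Matrix.cons_val_zero, Matrix.cons_val_one,
    Matrix.cons_val_two, Matrix.head_cons, Matrix.tail_cons]
  field_simp
  ring

/-- The meridian projection is differentiable off the axis, with
`D(meridian)(x) h = (⟪eR x, h⟫, h 2)`. [folklore] -/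
theorem hasFDerivAt_meridian {x : ℝ³} (hx : cylRadius x ≠ 0) :
    HasFDerivAt meridian
      ((innerSL ℝ (eR x)).prod (EuclideanSpace.proj (2 : Fin 3) : ℝ³ →L[ℝ] ℝ)) x :=
  (hasFDerivAt_cylRadius hx).prodMk (EuclideanSpace.proj (2 : Fin 3) : ℝ³ →L[ℝ] ℝ).hasFDerivAt

section Calculus

variable {F : Type*} [NormedAddCommGroup F] [InnerProductSpace ℝ F]

/-- **Chain rule through the meridian coordinates**: for `G : ℝ × ℝ → F` differentiable at
`(r, z) = meridian x`, `x` off the axis, `D(G ∘ meridian)(x) h = DG(r, z) (⟪eR x, h⟫, h 2)`. [folklore] -/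
theorem hasFDerivAt_comp_meridian {G : ℝ × ℝ → F} {x : ℝ³} (hx : cylRadius x ≠ 0)
    (hG : DifferentiableAt ℝ G (meridian x)) :
    HasFDerivAt (fun y => G (meridian y))
      ((fderiv ℝ G (meridian x)).comp
        ((innerSL ℝ (eR x)).prod (EuclideanSpace.proj (2 : Fin 3) : ℝ³ →L[ℝ] ℝ))) x :=
  hG.hasFDerivAt.comp x (hasFDerivAt_meridian hx)

/-- Applied form of the chain rule: `D(G ∘ meridian)(x) h = DG(r, z)(⟪eR x, h⟫, h 2)`. [folklore] -/
theorem fderiv_comp_meridian_apply {G : ℝ × ℝ → F} {x : ℝ³} (hx : cylRadius x ≠ 0)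
    (hG : DifferentiableAt ℝ G (meridian x)) (h : ℝ³) :
    fderiv ℝ (fun y => G (meridian y)) x h = fderiv ℝ G (meridian x) (⟪eR x, h⟫, h 2) := by
  rw [(hasFDerivAt_comp_meridian hx hG).fderiv]
  simp [innerSL_apply_apply]

/-- A scalar of the form `G ∘ meridian` is differentiable off the axis where `G` is. [folklore] -/
theorem differentiableAt_comp_meridian {G : ℝ × ℝ → F} {x : ℝ³} (hx : cylRadius x ≠ 0)
    (hG : DifferentiableAt ℝ G (meridian x)) : DifferentiableAt ℝ (fun y => G (meridian y)) x :=
  (hasFDerivAt_comp_meridian hx hG).differentiableAt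

/-- **The material derivative on axisymmetric scalars**: off the axis,
`(u·∇)(G ∘ meridian)(x) = DG(r, z)(u_r, u_z) = u^r ∂ᵣG + u^z ∂_zG`, with the cylindrical
components `u_r = radialVelocity u x = ⟪u, e_r⟫`, `u_z = axialVelocity u x = u 2`
(Chen–Hou, Part I (6.1): `u^r ∂ᵣ + u^z ∂_z`). [cite: arXiv221007191, §6 (6.1) p. 53] -/
theorem convect_comp_meridian {G : ℝ × ℝ → F} {u : ℝ³ → ℝ³} {x : ℝ³} (hx : cylRadius x ≠ 0)
    (hG : DifferentiableAt ℝ G (meridian x)) :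
    convect u (fun y => G (meridian y)) x =
      fderiv ℝ G (meridian x) (radialVelocity u x, axialVelocity u x) := by
  rw [convect_apply, fderiv_comp_meridian_apply hx hG, radialVelocity, axialVelocity,
    real_inner_comm (u x) (eR x)]

/-- `e_r` has no axial component. [folklore] -/
@[simp] theorem eR_apply_two (x : ℝ³) : eR x 2 = 0 := by
  simp [eR]

/-- `e_r ⟂ e_z`. [folklore] -/
theorem inner_eR_eZ (x : ℝ³) : ⟪eR x, eZ⟫ = 0 := by
  rw [eZ, EuclideanSpace.inner_single_right]; simp

/-- Off the axis `e_r` is a unit vector: `⟪eR x, eR x⟫ = 1`. [folklore] -/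
theorem inner_eR_self {x : ℝ³} (hx : cylRadius x ≠ 0) : ⟪eR x, eR x⟫ = 1 := by
  have hr := cylRadius_sq x
  simp only [eR, inner_smul_left, inner_smul_right, PiLp.inner_apply,
    RCLike.inner_apply, conj_trivial, Fin.sum_univ_three, Matrix.cons_val_zero,
    Matrix.cons_val_one, Matrix.cons_val_two, Matrix.head_cons, Matrix.tail_cons]
  field_simp
  linear_combination -hr

/-- **Axial derivative**: `∂_{e_z}(G ∘ meridian)(x) = DG(r, z)(0, 1) = ∂_zG` off the axis. [folklore] -/
theorem partialDeriv_eZ_comp_meridian {G : ℝ × ℝ → F} {x : ℝ³} (hx : cylRadius x ≠ 0)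
    (hG : DifferentiableAt ℝ G (meridian x)) :
    partialDeriv eZ (fun y => G (meridian y)) x = fderiv ℝ G (meridian x) (0, 1) := by
  rw [partialDeriv_apply, fderiv_comp_meridian_apply hx hG, inner_eR_eZ]
  simp [eZ]

/-- **Radial derivative**: `∂_{e_r}(G ∘ meridian)(x) = DG(r, z)(1, 0) = ∂ᵣG` off the axis. [folklore] -/
theorem partialDeriv_eR_comp_meridian {G : ℝ × ℝ → F} {x : ℝ³} (hx : cylRadius x ≠ 0)
    (hG : DifferentiableAt ℝ G (meridian x)) :
    partialDeriv (eR x) (fun y => G (meridian y)) x = fderiv ℝ G (meridian x) (1, 0) := by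
  rw [partialDeriv_apply, fderiv_comp_meridian_apply hx hG, inner_eR_self hx, eR_apply_two]

end Calculus

end Literature.Analysis.FluidPDE
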